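import Summits.SmoothPoincare4.SmoothPoincare4.Theorems.SullivanDualWitnessChargeCapDefs
import Mathlib.Analysis.Calculus.Deriv.Inv
import Mathlib.Analysis.Calculus.ContDiff.Operations
import Mathlib.Geometry.Manifold.ContMDiff.NormedSpace
import Mathlib.Geometry.Manifold.ContMDiff.Constructions

/-!
# Stub `stub_leafFloc` of skeleton v15 (crux `WitnessCharge`, stmt-SmoothPoincare4-7824, line
`Sketch`, lead c8) — joint smoothness and injective differential of the family `Floc`

Registered helper `helper_leafFloc_joint`. Fix cap data `D`, the jointly smooth family of leaves
`(a, z) ↦ U a z`, `(a, w) ↦ V a w` (`‖a‖ < ε`) with jointly injective differentials, the intercept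
chart `α : ball b₀ δ → ball 0 ε₁` (smooth, `dα` bijective), the smooth functions `wz` (the point of
the leaf on the added line), `cf ≠ 0`, `df` on `ball 0 ε₁` (the affine renormalisation constants —
their nature is irrelevant here), and a family `Floc : ℂ → ℂ → Σ ∖ p` which, for `b ∈ ball b₀ δ`,
`a = α b`, `ξ' = cf a (ξ − df a)`, `w₀ = wz a`, is read in the leaf through the two pieces of the
puncture parametrisation:
`ι (Floc b ξ) = U a (ξ' / (1 + w₀ ξ'))` where `1 + w₀ ξ' ≠ 0` and `ι (Floc b ξ) = V a (w₀ + ξ'⁻¹)`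
where `ξ' ≠ 0`.

Then `(b, ξ) ↦ Floc b ξ` is `C^∞` on `ball b₀ δ ×ˢ univ` with injective differential at every point,
and consequently each `Floc b` is `C^∞` with injective differential.

Proof. The two pieces are relatively open and cover; on each, `Floc = ιinv ∘ Ev ∘ Ψ` with `Ev` the
evaluation map of `U` (resp. `V`), smooth on `ball 0 ε ×ˢ univ` with injective differential, and
`Ψ (b, ξ) = (α b, m_b(ξ'))` smooth (`m_b` the Möbius map `s ↦ s/(1 + w₀ s)` resp. `s ↦ w₀ + s⁻¹`);
`ιinv` is smooth on `range ι` with `dιinv = id` there. The differential of `Ψ` is block lower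
triangular with diagonal blocks `dα(b)` (injective) and multiplication by
`∂_ξ = cf a · m_b'(ξ') ≠ 0`, hence injective (`leafFloc_mfderiv_injective_of_piece`).
-/

noncomputable section

set_option linter.dupNamespace false

open scoped Manifold ContDiff Topology
open Set Filter Literature.Geometry.Symplectic Literature.Topology.FourManifolds

namespace Summit.SmoothPoincare4.SmoothPoincare4.Theorems.WitnessCharge.PencilIncompleteness

variable {S : HomotopySphere 4} {p : S.carrier}
  {J : ∀ x : punctured p, TangentSpace (𝓡 4) x →L[ℝ] TangentSpace (𝓡 4) x} {ε' : ℝ}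

/-- A block lower-triangular real-linear map `v ↦ (A v.1, L v)` of `ℂ × ℂ` with `A` injective and
`L (0, v₂) = v₂ κ`, `κ ≠ 0`, is injective. -/
theorem leafFloc_injective_blockTriangular {A : ℂ →L[ℝ] ℂ} {L : ℂ × ℂ →L[ℝ] ℂ} {κ : ℂ}
    (hA : Function.Injective A) (hL : ∀ v : ℂ, L (0, v) = v * κ) (hκ : κ ≠ 0) :
    Function.Injective ((A.comp (ContinuousLinearMap.fst ℝ ℂ ℂ)).prod L) := by
  refine (injective_iff_map_eq_zero _).2 fun v hv => ?_
  rw [ContinuousLinearMap.prod_apply, Prod.mk_eq_zero] at hv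
  obtain ⟨h1, h2⟩ := hv
  have hv1 : v.1 = 0 := (injective_iff_map_eq_zero A).1 hA _ h1
  have hv' : v = (0, v.2) := Prod.ext hv1 rfl
  rw [hv', hL] at h2
  exact Prod.ext hv1 ((mul_eq_zero.1 h2).resolve_right hκ)

/-- **The differential of one piece `ιinv ∘ Ev ∘ Ψ` is injective.** Here `Ψ q = (α q.1, φ q)` with
`dα` injective at `b` and `∂_ξ φ (b, ·) = κ ≠ 0` at `ξ` (a complex derivative), `Ev` is smooth on
the open `T ∋ Ψ (b, ξ)` with injective differential there, `Ev (Ψ (b, ξ)) = ι (Φ (b, ξ))`, and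
`Φ = ιinv ∘ Ev ∘ Ψ` near `(b, ξ)`; then `dΦ (b, ξ) = dιinv ∘ dEv ∘ dΨ = id ∘ dEv ∘ dΨ` is
injective. -/
theorem leafFloc_mfderiv_injective_of_piece (D : CapData S p J ε') {Ev : ℂ × ℂ → D.X} {T : Set (ℂ × ℂ)}
    {α : ℂ → ℂ} {φ : ℂ × ℂ → ℂ} {Φ : ℂ × ℂ → punctured p} {A : ℂ →L[ℝ] ℂ} {κ b ξ : ℂ}
    (hT : IsOpen T) (hEv : ContMDiffOn 𝓘(ℝ, ℂ × ℂ) (𝓡 4) ∞ Ev T) (hΨT : (α b, φ (b, ξ)) ∈ T)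
    (hEvinj : Function.Injective (mfderiv 𝓘(ℝ, ℂ × ℂ) (𝓡 4) Ev (α b, φ (b, ξ))))
    (hαd : HasFDerivAt α A b) (hA : Function.Injective A) (hφ : DifferentiableAt ℝ φ (b, ξ))
    (hκ : HasDerivAt (fun ξ' => φ (b, ξ')) κ ξ) (hκ0 : κ ≠ 0)
    (hpt : Ev (α b, φ (b, ξ)) = D.ι (Φ (b, ξ)))
    (hΦ : Φ =ᶠ[𝓝 (b, ξ)] fun q => D.ιinv (Ev (α q.1, φ q))) :
    Function.Injective (mfderiv 𝓘(ℝ, ℂ × ℂ) (𝓡 4) Φ (b, ξ)) := by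
  -- the differential of `Ψ`
  set Ψ : ℂ × ℂ → ℂ × ℂ := fun q => (α q.1, φ q) with hΨ
  set L : ℂ × ℂ →L[ℝ] ℂ × ℂ := (A.comp (ContinuousLinearMap.fst ℝ ℂ ℂ)).prod (fderiv ℝ φ (b, ξ))
    with hL
  have hΨd : HasFDerivAt Ψ L (b, ξ) := (hαd.comp (b, ξ) hasFDerivAt_fst).prodMk hφ.hasFDerivAt
  -- the partial derivative of `φ` in `ξ`
  have hslice : HasFDerivAt (fun ξ' => φ (b, ξ'))
      ((fderiv ℝ φ (b, ξ)).comp (ContinuousLinearMap.inr ℝ ℂ ℂ)) ξ :=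
    hφ.hasFDerivAt.comp ξ (hasFDerivAt_prodMk_right b ξ)
  have hslice' : HasFDerivAt (fun ξ' => φ (b, ξ'))
      ((ContinuousLinearMap.smulRight (1 : ℂ →L[ℂ] ℂ) κ).restrictScalars ℝ) ξ :=
    hκ.hasFDerivAt.restrictScalars ℝ
  have hpartial : ∀ v : ℂ, fderiv ℝ φ (b, ξ) (0, v) = v * κ := by
    intro v
    have e := congrArg (fun M : ℂ →L[ℝ] ℂ => M v) (hslice.unique hslice')
    simpa using e
  have hLinj : Function.Injective L := leafFloc_injective_blockTriangular hA hpartial hκ0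
  -- the manifold chain rule
  have hEvd : MDifferentiableAt 𝓘(ℝ, ℂ × ℂ) (𝓡 4) Ev (Ψ (b, ξ)) :=
    (hEv.contMDiffAt (hT.mem_nhds hΨT)).mdifferentiableAt (by simp)
  have hcomp1 : HasMFDerivAt 𝓘(ℝ, ℂ × ℂ) (𝓡 4) (Ev ∘ Ψ) (b, ξ)
      ((mfderiv 𝓘(ℝ, ℂ × ℂ) (𝓡 4) Ev (Ψ (b, ξ))).comp L) :=
    hEvd.hasMFDerivAt.comp (b, ξ) hΨd.hasMFDerivAt
  have hιinv : HasMFDerivAt (𝓡 4) (𝓡 4) D.ιinv (Ev (Ψ (b, ξ)))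
      (ContinuousLinearMap.id ℝ (EuclideanSpace ℝ (Fin 4))) := by
    have h := D.hasMFDerivAt_ιinv (Φ (b, ξ))
    rw [← hpt] at h
    exact h
  have hcomp2 := hιinv.comp (b, ξ) hcomp1
  have hmf : mfderiv 𝓘(ℝ, ℂ × ℂ) (𝓡 4) Φ (b, ξ) =
      (ContinuousLinearMap.id ℝ (EuclideanSpace ℝ (Fin 4))).comp
        ((mfderiv 𝓘(ℝ, ℂ × ℂ) (𝓡 4) Ev (Ψ (b, ξ))).comp L) := by
    rw [hΦ.mfderiv_eq]
    exact hcomp2.mfderiv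
  rw [hmf]
  exact fun v₁ v₂ h => hLinj (hEvinj h)

/-- **Registered helper `helper_leafFloc_joint` — joint smoothness and injective differential of
the family of renormalised leaves.** See the module docstring. -/
theorem helper_leafFloc_joint :
    ∀ (S : HomotopySphere 4) (p : S.carrier)
      (J : ∀ x : punctured p, TangentSpace (𝓡 4) x →L[ℝ] TangentSpace (𝓡 4) x) (ε' : ℝ)
      (D : CapData S p J ε') (U V : ℂ → ℂ → D.X) (ε ε₁ δ : ℝ) (b₀ : ℂ) (wz α cf df : ℂ → ℂ)
      (Floc : ℂ → ℂ → punctured p),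
      ContMDiffOn 𝓘(ℝ, ℂ × ℂ) (𝓡 4) ∞ (fun q : ℂ × ℂ => U q.1 q.2) (Metric.ball 0 ε ×ˢ univ) →
      ContMDiffOn 𝓘(ℝ, ℂ × ℂ) (𝓡 4) ∞ (fun q : ℂ × ℂ => V q.1 q.2) (Metric.ball 0 ε ×ˢ univ) →
      (∀ q ∈ Metric.ball (0 : ℂ) ε ×ˢ (univ : Set ℂ),
        Function.Injective (mfderiv 𝓘(ℝ, ℂ × ℂ) (𝓡 4) (fun q : ℂ × ℂ => U q.1 q.2) q) ∧
        Function.Injective (mfderiv 𝓘(ℝ, ℂ × ℂ) (𝓡 4) (fun q : ℂ × ℂ => V q.1 q.2) q)) →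
      ε₁ ≤ ε →
      ContDiffOn ℝ ∞ wz (Metric.ball 0 ε₁) → ContDiffOn ℝ ∞ cf (Metric.ball 0 ε₁) →
      ContDiffOn ℝ ∞ df (Metric.ball 0 ε₁) → (∀ a ∈ Metric.ball (0 : ℂ) ε₁, cf a ≠ 0) →
      ContDiffOn ℝ ∞ α (Metric.ball b₀ δ) →
      (∀ b ∈ Metric.ball b₀ δ, α b ∈ Metric.ball (0 : ℂ) ε₁) →
      (∀ b ∈ Metric.ball b₀ δ, Function.Bijective (fderiv ℝ α b)) →
      (∀ b ∈ Metric.ball b₀ δ, ∀ ξ : ℂ,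
        1 + wz (α b) * (cf (α b) * (ξ - df (α b))) ≠ 0 →
          D.ι (Floc b ξ) = U (α b)
            ((cf (α b) * (ξ - df (α b))) / (1 + wz (α b) * (cf (α b) * (ξ - df (α b)))))) →
      (∀ b ∈ Metric.ball b₀ δ, ∀ ξ : ℂ, cf (α b) * (ξ - df (α b)) ≠ 0 →
          D.ι (Floc b ξ) = V (α b) (wz (α b) + (cf (α b) * (ξ - df (α b)))⁻¹)) →
      ContMDiffOn 𝓘(ℝ, ℂ × ℂ) (𝓡 4) ∞ (fun q : ℂ × ℂ => Floc q.1 q.2)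
          ((Metric.ball b₀ δ) ×ˢ (univ : Set ℂ)) ∧
      (∀ q : ℂ × ℂ, q.1 ∈ Metric.ball b₀ δ →
          Function.Injective (mfderiv 𝓘(ℝ, ℂ × ℂ) (𝓡 4) (fun q : ℂ × ℂ => Floc q.1 q.2) q)) ∧
      (∀ b ∈ Metric.ball b₀ δ, ContMDiff 𝓘(ℝ, ℂ) (𝓡 4) ∞ (Floc b)) ∧
      (∀ b ∈ Metric.ball b₀ δ, ∀ ξ : ℂ,
          Function.Injective (mfderiv 𝓘(ℝ, ℂ) (𝓡 4) (Floc b) ξ)) := by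
  intro S p J ε' D U V ε ε₁ δ b₀ wz α cf df Floc hEvU hEvV hinj hε₁ε hwz hcf hdf hcf0 hα hαmaps
    hDα hA hB
  -- abbreviations (kept opaque, with unfolding equations)
  obtain ⟨sc, hsc⟩ : ∃ sc : ℂ × ℂ → ℂ, ∀ q, sc q = cf (α q.1) * (q.2 - df (α q.1)) :=
    ⟨_, fun _ => rfl⟩
  obtain ⟨w0, hw0⟩ : ∃ w0 : ℂ × ℂ → ℂ, ∀ q, w0 q = wz (α q.1) := ⟨_, fun _ => rfl⟩
  obtain ⟨φA, hφA⟩ : ∃ φ : ℂ × ℂ → ℂ, ∀ q, φ q = sc q / (1 + w0 q * sc q) := ⟨_, fun _ => rfl⟩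
  obtain ⟨φB, hφB⟩ : ∃ φ : ℂ × ℂ → ℂ, ∀ q, φ q = w0 q + (sc q)⁻¹ := ⟨_, fun _ => rfl⟩
  set Ω : Set (ℂ × ℂ) := Metric.ball b₀ δ ×ˢ (univ : Set ℂ) with hΩ
  set Φ : ℂ × ℂ → punctured p := fun q => Floc q.1 q.2 with hΦ
  set T : Set (ℂ × ℂ) := Metric.ball (0 : ℂ) ε ×ˢ (univ : Set ℂ) with hT
  have hTo : IsOpen T := Metric.isOpen_ball.prod isOpen_univ
  have hΩo : IsOpen Ω := Metric.isOpen_ball.prod isOpen_univ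
  have hΩ1 : ∀ q ∈ Ω, q.1 ∈ Metric.ball b₀ δ := fun q hq => (mem_prod.1 hq).1
  have hαq' : ∀ q ∈ Ω, α q.1 ∈ Metric.ball (0 : ℂ) ε₁ := fun q hq => hαmaps _ (hΩ1 q hq)
  have hαT : ∀ q ∈ Ω, ∀ s : ℂ, (α q.1, s) ∈ T := fun q hq s =>
    ⟨Metric.ball_subset_ball hε₁ε (hαq' q hq), mem_univ _⟩
  -- smoothness of the coefficient maps on `Ω`
  have hαq : ContDiffOn ℝ ∞ (fun q : ℂ × ℂ => α q.1) Ω :=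
    hα.comp contDiffOn_fst fun q hq => hΩ1 q hq
  have hw0s : ContDiffOn ℝ ∞ w0 Ω := (hwz.comp hαq hαq').congr fun q _ => hw0 q
  have hcfs : ContDiffOn ℝ ∞ (fun q : ℂ × ℂ => cf (α q.1)) Ω := hcf.comp hαq hαq'
  have hdfs : ContDiffOn ℝ ∞ (fun q : ℂ × ℂ => df (α q.1)) Ω := hdf.comp hαq hαq'
  have hscs : ContDiffOn ℝ ∞ sc Ω := (hcfs.mul (contDiffOn_snd.sub hdfs)).congr fun q _ => hsc q
  -- the two pieces
  set OA : Set (ℂ × ℂ) := Ω ∩ (fun q => 1 + w0 q * sc q) ⁻¹' {0}ᶜ with hOA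
  set OB : Set (ℂ × ℂ) := Ω ∩ sc ⁻¹' {0}ᶜ with hOB
  have hOAo : IsOpen OA :=
    (continuousOn_const.add (hw0s.continuousOn.mul hscs.continuousOn)).isOpen_inter_preimage hΩo
      isOpen_compl_singleton
  have hOBo : IsOpen OB := hscs.continuousOn.isOpen_inter_preimage hΩo isOpen_compl_singleton
  have hOA2 : ∀ q ∈ OA, 1 + w0 q * sc q ≠ 0 := fun q hq => hq.2
  have hOB2 : ∀ q ∈ OB, sc q ≠ 0 := fun q hq => hq.2
  have hcover : ∀ q ∈ Ω, q ∈ OA ∨ q ∈ OB := by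
    intro q hq
    by_cases h0 : sc q = 0
    · refine Or.inl ⟨hq, ?_⟩
      show 1 + w0 q * sc q ≠ 0
      rw [h0, mul_zero, add_zero]; exact one_ne_zero
    · exact Or.inr ⟨hq, h0⟩
  -- the formulas on the pieces
  have hΦA : ∀ q ∈ OA, D.ι (Φ q) = U (α q.1) (φA q) := by
    intro q hq
    have h1 : 1 + wz (α q.1) * (cf (α q.1) * (q.2 - df (α q.1))) ≠ 0 := by
      have h := hOA2 q hq; rwa [hw0, hsc] at h
    show D.ι (Floc q.1 q.2) = U (α q.1) (φA q)
    rw [hA q.1 (hΩ1 q hq.1) q.2 h1, hφA, hsc, hw0]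
  have hΦB : ∀ q ∈ OB, D.ι (Φ q) = V (α q.1) (φB q) := by
    intro q hq
    have h1 : cf (α q.1) * (q.2 - df (α q.1)) ≠ 0 := by
      have h := hOB2 q hq; rwa [hsc] at h
    show D.ι (Floc q.1 q.2) = V (α q.1) (φB q)
    rw [hB q.1 (hΩ1 q hq.1) q.2 h1, hφB, hsc, hw0]
  -- smoothness of the pieces
  have hφAs : ContDiffOn ℝ ∞ φA OA := by
    have h1 : ContDiffOn ℝ ∞ (fun q => sc q * (1 + w0 q * sc q)⁻¹) OA :=
      (hscs.mono inter_subset_left).mul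
        (((contDiffOn_const.add (hw0s.mul hscs)).mono inter_subset_left).inv hOA2)
    exact h1.congr fun q _ => by rw [hφA, div_eq_mul_inv]
  have hφBs : ContDiffOn ℝ ∞ φB OB := by
    have h1 : ContDiffOn ℝ ∞ (fun q => w0 q + (sc q)⁻¹) OB :=
      (hw0s.mono inter_subset_left).add ((hscs.mono inter_subset_left).inv hOB2)
    exact h1.congr fun q _ => by rw [hφB]
  have hΦAs : ContMDiffOn 𝓘(ℝ, ℂ × ℂ) (𝓡 4) ∞ Φ OA := by
    have hΨ : ContMDiffOn 𝓘(ℝ, ℂ × ℂ) 𝓘(ℝ, ℂ × ℂ) ∞ (fun q => (α q.1, φA q)) OA :=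
      ((hαq.mono inter_subset_left).prodMk hφAs).contMDiffOn
    have h1 : ContMDiffOn 𝓘(ℝ, ℂ × ℂ) (𝓡 4) ∞ (fun q => U (α q.1) (φA q)) OA :=
      hEvU.comp hΨ fun q hq => hαT q hq.1 _
    have h2 : ContMDiffOn 𝓘(ℝ, ℂ × ℂ) (𝓡 4) ∞ (fun q => D.ιinv (U (α q.1) (φA q))) OA :=
      D.contMDiffOn_ιinv.comp h1 fun q hq => ⟨Φ q, hΦA q hq⟩
    refine h2.congr fun q hq => ?_
    show Φ q = D.ιinv (U (α q.1) (φA q))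
    rw [← hΦA q hq, D.ιinv_ι]
  have hΦBs : ContMDiffOn 𝓘(ℝ, ℂ × ℂ) (𝓡 4) ∞ Φ OB := by
    have hΨ : ContMDiffOn 𝓘(ℝ, ℂ × ℂ) 𝓘(ℝ, ℂ × ℂ) ∞ (fun q => (α q.1, φB q)) OB :=
      ((hαq.mono inter_subset_left).prodMk hφBs).contMDiffOn
    have h1 : ContMDiffOn 𝓘(ℝ, ℂ × ℂ) (𝓡 4) ∞ (fun q => V (α q.1) (φB q)) OB :=
      hEvV.comp hΨ fun q hq => hαT q hq.1 _
    have h2 : ContMDiffOn 𝓘(ℝ, ℂ × ℂ) (𝓡 4) ∞ (fun q => D.ιinv (V (α q.1) (φB q))) OB :=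
      D.contMDiffOn_ιinv.comp h1 fun q hq => ⟨Φ q, hΦB q hq⟩
    refine h2.congr fun q hq => ?_
    show Φ q = D.ιinv (V (α q.1) (φB q))
    rw [← hΦB q hq, D.ιinv_ι]
  -- joint smoothness
  have hΦs : ContMDiffOn 𝓘(ℝ, ℂ × ℂ) (𝓡 4) ∞ Φ Ω := by
    refine contMDiffOn_of_locally_contMDiffOn fun q hq => ?_
    rcases hcover q hq with hqA | hqB
    · exact ⟨OA, hOAo, hqA, hΦAs.mono inter_subset_right⟩
    · exact ⟨OB, hOBo, hqB, hΦBs.mono inter_subset_right⟩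
  -- injectivity of the joint differential
  have hDinj : ∀ b ∈ Metric.ball b₀ δ, ∀ ξ : ℂ,
      Function.Injective (mfderiv 𝓘(ℝ, ℂ × ℂ) (𝓡 4) Φ (b, ξ)) := by
    intro b hb ξ
    have hq : (b, ξ) ∈ Ω := ⟨hb, mem_univ _⟩
    have hαd : HasFDerivAt α (fderiv ℝ α b) b :=
      ((hα.contDiffAt (Metric.isOpen_ball.mem_nhds hb)).differentiableAt (by simp)).hasFDerivAt
    have hAinj : Function.Injective (fderiv ℝ α b) := (hDα b hb).1
    set c : ℂ := cf (α b) with hc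
    set dd : ℂ := df (α b) with hdd
    set w : ℂ := wz (α b) with hw
    have hc0 : c ≠ 0 := hcf0 _ (hαmaps b hb)
    have hN : HasDerivAt (fun ξ' : ℂ => c * (ξ' - dd)) c ξ := by
      simpa using ((hasDerivAt_id ξ).sub_const dd).const_mul c
    rcases hcover (b, ξ) hq with hqA | hqB
    · -- piece A
      have hDn0 : 1 + w * (c * (ξ - dd)) ≠ 0 := by
        have h := hOA2 _ hqA; rwa [hw0, hsc] at h
      have hDn : HasDerivAt (fun ξ' : ℂ => 1 + w * (c * (ξ' - dd))) (w * c) ξ := by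
        simpa using (hN.const_mul w).const_add 1
      have hκ : HasDerivAt (fun ξ' => φA (b, ξ')) (c / (1 + w * (c * (ξ - dd))) ^ 2) ξ := by
        have hQ := hN.div hDn hDn0
        have e : (fun ξ' => φA (b, ξ')) = fun ξ' => c * (ξ' - dd) / (1 + w * (c * (ξ' - dd))) :=
          funext fun ξ' => by rw [hφA, hsc, hw0]
        rw [e]
        refine hQ.congr_deriv ?_
        field_simp
        ring
      refine leafFloc_mfderiv_injective_of_piece D hTo hEvU (hαT _ hq _) (hinj _ (hαT _ hq _)).1 hαd hAinj
        ((hφAs.contDiffAt (hOAo.mem_nhds hqA)).differentiableAt (by simp)) hκ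
        (div_ne_zero hc0 (pow_ne_zero 2 hDn0)) (hΦA _ hqA).symm ?_
      filter_upwards [hOAo.mem_nhds hqA] with q hq'
      rw [← hΦA q hq', D.ιinv_ι]
    · -- piece B
      have hs0 : c * (ξ - dd) ≠ 0 := by
        have h := hOB2 _ hqB; rwa [hsc] at h
      have hκ : HasDerivAt (fun ξ' => φB (b, ξ')) (-c / (c * (ξ - dd)) ^ 2) ξ := by
        have hQ := (hN.inv hs0).const_add w
        have e : (fun ξ' => φB (b, ξ')) = fun ξ' => w + (c * (ξ' - dd))⁻¹ :=
          funext fun ξ' => by rw [hφB, hsc, hw0]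
        rw [e]
        refine hQ.congr_deriv ?_
        ring
      refine leafFloc_mfderiv_injective_of_piece D hTo hEvV (hαT _ hq _) (hinj _ (hαT _ hq _)).2 hαd hAinj
        ((hφBs.contDiffAt (hOBo.mem_nhds hqB)).differentiableAt (by simp)) hκ
        (div_ne_zero (neg_ne_zero.2 hc0) (pow_ne_zero 2 hs0)) (hΦB _ hqB).symm ?_
      filter_upwards [hOBo.mem_nhds hqB] with q hq'
      rw [← hΦB q hq', D.ιinv_ι]
  -- slices
  have hsl : ∀ b ∈ Metric.ball b₀ δ, ContMDiff 𝓘(ℝ, ℂ) (𝓡 4) ∞ (Floc b) := fun b hb =>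
    hΦs.comp_contMDiff (f := fun ξ : ℂ => (b, ξ))
      (contDiff_prodMk_right (𝕜 := ℝ) (n := ∞) b).contMDiff fun ξ => ⟨hb, mem_univ _⟩
  have hsl' : ∀ b ∈ Metric.ball b₀ δ, ∀ ξ : ℂ,
      Function.Injective (mfderiv 𝓘(ℝ, ℂ) (𝓡 4) (Floc b) ξ) := by
    intro b hb ξ
    have hΦd : MDifferentiableAt 𝓘(ℝ, ℂ × ℂ) (𝓡 4) Φ (b, ξ) :=
      (hΦs.contMDiffAt (hΩo.mem_nhds ⟨hb, mem_univ _⟩)).mdifferentiableAt (by simp)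
    have hs : HasMFDerivAt 𝓘(ℝ, ℂ) 𝓘(ℝ, ℂ × ℂ) (fun ξ' : ℂ => (b, ξ')) ξ
        (ContinuousLinearMap.inr ℝ ℂ ℂ) :=
      (hasFDerivAt_prodMk_right b ξ).hasMFDerivAt
    have hmf : mfderiv 𝓘(ℝ, ℂ) (𝓡 4) (Floc b) ξ =
        (mfderiv 𝓘(ℝ, ℂ × ℂ) (𝓡 4) Φ (b, ξ)).comp (ContinuousLinearMap.inr ℝ ℂ ℂ) :=
      (hΦd.hasMFDerivAt.comp ξ hs).mfderiv
    rw [hmf]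
    intro v₁ v₂ h
    have h' : ((0 : ℂ), v₁) = ((0 : ℂ), v₂) := hDinj b hb ξ h
    exact (Prod.mk.injEq _ _ _ _ ▸ h').2
  refine ⟨hΦs, fun q hq => hDinj q.1 hq q.2, hsl, hsl'⟩

end Summit.SmoothPoincare4.SmoothPoincare4.Theorems.WitnessCharge.PencilIncompleteness
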